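import Summits.ABC.IUTFork.LanaRss
import Summits.ABC.IUTFork.ForkLana
import HarnessLib

/-!
# L-LANA objects V bis: the measure-level (9-1) feeds the skeleton's `OutputRegions` (VIII)

Record-only file (D-0012) of the abc-iut cell (seat abc-iut-c312-4, L-LANA level); TAKES NO SIDE on
[IUTchIII] Cor. 3.12. `ForkLana.lean` (VIII) typed LANA's (9-1) "at the level of log-volume" over the
posited datum `OutputRegions` (admissible `S`, their log-volumes, `−|log(Θ)|` with the POSITED inequality
`vol_le_hull : ∀ s, vol s ≤ −|log(Θ)|`, and `−|log(q)|`). `LanaRss.lean` made regions and volumes real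
(a Mathlib measure space standing for `VC(I_v)`). This file is the bridge: an `EtaData` whose suitable
output regions `LGP·S` lie inside the hull region (§8.1 (f) p. 41: the hull is "the holomorphic hull … of"
"the union of the possible image regions") DETERMINES an `OutputRegions` in which `vol_le_hull` is a
THEOREM (monotonicity of the measure, `Region.logVol_mono`), and under this bridge

* `EtaData.mainGoal_iff_represented`: (9-1) as printed (§9.2 p. 46, equality of the classes of
  `{q̲_v O_v}` and `1·S` in `ℝ^ss`) ⟺ VIII's `OutputRegions.Represented` (§9.3 p. 46 "at the level of
  degree (log-volume), the rigidified `q`-pilot is represented in the output regions");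
* `EtaData.cor312_iff`: VIII's `Cor312` for the carried datum IS `−|log(q)| ≤ −|log(Θ)|` for the
  measure-level log-volumes; `EtaData.toOutputRegions_cor312_of_mainGoal` = VIII `cor312_of_represented`
  transported ([IUTchIII] Step (xi-f); LANA §8.3 p. 43).

[cite: LANA2026Report, §9.2–9.3 p. 46, §8.1 (f) p. 41] NOT here: any judgement.
-/

noncomputable section

open MeasureTheory

namespace Summit.ABC
namespace IUTFork
namespace EtaData

variable {Ω : Type} [MeasurableSpace Ω] {μ : Measure Ω} (E : EtaData μ)

/-- The hypothesis that makes an `η`-datum an `OutputRegions`: every suitable output region `LGP·S` lies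
inside the hull region (§8.1 (f): `U^{hol} ⊇ ⋃_λ U_λ`). [cite: LANA2026Report, §8.1 (f) p. 41] -/
def SuitableInHull : Prop := ∀ S ∈ E.Suitable, (E.LGP S).carrier ⊆ E.hull.carrier

/-- **The bridge**: the skeleton's `OutputRegions` (VIII) determined by an `η`-datum — admissible `S` :=
the suitable ones, `vol s := log-vol(LGP·S)`, `−|log(Θ)| := log-vol(hull)`, `−|log(q)| := log-vol({q̲_v O_v})`,
and VIII's posited `vol_le_hull` PROVED by monotonicity of the measure.
[cite: LANA2026Report, §9.2 p. 46, §8.1 (f),(h) p. 41] -/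
def toOutputRegions (h : E.SuitableInHull) : OutputRegions where
  S := E.Suitable
  vol s := (E.LGP s.1).logVol
  negLogTheta := E.negAbsLogTheta
  vol_le_hull s := (E.LGP s.1).logVol_mono E.hull (h s.1 s.2)
  negAbsLogq := E.negAbsLogq

/-- The carried `−|log(q)|` is the measure-level one. [cite: LANA2026Report, §8.1 (a) p. 40] -/
@[simp] theorem toOutputRegions_negAbsLogq (h : E.SuitableInHull) :
    (E.toOutputRegions h).negAbsLogq = E.negAbsLogq := rfl

/-- The carried `−|log(Θ)|` is the measure-level one. [cite: LANA2026Report, §8.1 (h) p. 41] -/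
@[simp] theorem toOutputRegions_negLogTheta (h : E.SuitableInHull) :
    (E.toOutputRegions h).negLogTheta = E.negAbsLogTheta := rfl

/-- **(9-1) as printed ⟺ VIII's `Represented`** (LANA §9.3: "(9-1) indicates that … at the level of
degree (log-volume), the rigidified `q`-pilot is represented in the output regions" — a biconditional for
the real objects). [cite: LANA2026Report, §9.3 p. 46] -/
theorem mainGoal_iff_represented (h : E.SuitableInHull) :
    E.MainGoal ↔ (E.toOutputRegions h).Represented := by
  rw [E.mainGoal_iff_logVol, OutputRegions.Represented]
  constructor
  · rintro ⟨S, hS, hvol⟩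
    exact ⟨⟨S, hS⟩, hvol⟩
  · rintro ⟨⟨S, hS⟩, hvol⟩
    exact ⟨S, hS, hvol⟩

/-- VIII's `Cor312` for the carried datum is the measure-level inequality `−|log(q)| ≤ −|log(Θ)|`.
[cite: LANA2026Report, §8.1 (8-1) p. 41] -/
theorem cor312_iff (h : E.SuitableInHull) :
    (E.toOutputRegions h).Cor312 ↔ E.negAbsLogq ≤ E.negAbsLogTheta := Iff.rfl

/-- **(9-1) ⟹ Cor. 3.12's inequality through the skeleton**: VIII `cor312_of_represented` ([IUTchIII]
Step (xi-f) "contains … hence ≤"; LANA §8.3) applied to the carried datum — agreeing with the direct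
measure-level proof `EtaData.cor312_of_mainGoal`. [cite: LANA2026Report, §8.3 p. 43] -/
theorem toOutputRegions_cor312_of_mainGoal (h : E.SuitableInHull) (hg : E.MainGoal) :
    (E.toOutputRegions h).Cor312 :=
  (E.toOutputRegions h).cor312_of_represented ((E.mainGoal_iff_represented h).mp hg)

/-- The two routes to the inequality agree (skeleton route = direct measure route).
[cite: LANA2026Report, §8.3 p. 43] -/
theorem cor312_routes_agree (h : E.SuitableInHull) (hg : E.MainGoal) :
    (E.cor312_iff h).mp (E.toOutputRegions_cor312_of_mainGoal h hg) = E.cor312_of_mainGoal h hg := rfl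

end EtaData

end IUTFork

end Summit.ABC

end
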